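import Mathlib
import HarnessLib

/-!
# PsdCert — a kernel-decided positive-semidefiniteness certificate for explicit integer matrices

HONEST FRAMING: ladder R1–R4 with certified numbers; no claim on H/H₀; first certified bounds; not a superconductivity
verdict.  Pure integer linear algebra; no physics.  Cell pub-hubbard, lane r2-eng-1 (g12); road step (iii) of the desk's
R6-2 (a TREE shape for an any-state cluster λ_min row): the per-block fact such a row needs is `B ⪰ 0` for an explicit
symmetric integer matrix `B` (a compressed `Φᵀ(H − σ)Φ` block).  This file decides that fact BY THE KERNEL
(`decide +kernel`) and proves the decision sound:

* §1 an UNTRUSTED oracle run inside the kernel: the right-looking LDLᵀ factorisation of `B − μ·1` in fixed-point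
  arithmetic at scale `s` (all divisions rounded; no property of it is proved or needed);
* §2 the VERIFIED check: with the oracle's integer pivots `D̂` and integer unit-lower factor `L̂` (diagonal `s`), form the
  EXACT residual `E := s²·B − L̂·diag(D̂)·L̂ᵀ` and accept iff `0 < s`, `B` is `n × n` and symmetric, every `D̂_k ≥ 0`, and every
  row of `E` is diagonally dominant (`Σ_{j ≠ i} |E_ij| ≤ E_ii`);
* §3 soundness `psdCert n s μ B = true → 0 ≤ xᵀ B x` for every real `x` (`form_nonneg_of_psdCert`), and the `Matrix.PosSemidef`
  form (`posSemidef_of_psdCert`): `s² B = L̂ D̂ L̂ᵀ + E` with both summands positive semidefinite (Gershgorin for `E`).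

Cost (kernel, measured on the farm, `pub-hubbard-r2-eng-1/psdcert-g12/bench/RESULTS.md`): ≈ 2·(n³/3) integer mult-adds at
≈ 0.1–0.3 ms each ⇒ n ≲ 150–200 per elaboration.  References: Golub–Van Loan (2013) §4.1 (LDLᵀ), Horn–Johnson (2013) Thm 6.1.10
(diagonal dominance ⇒ PSD), Rump (2006) «Verification of positive definiteness» (the residual idea, here with an exact residual).
All statements [folklore].

FILE SPLIT (400-line rule; FILER lit g35, bodies byte-identical to the staged master `psdcert-g12/lean-staged/PsdCert.lean`
83d79bad0b552655): part I = §1 (oracle) + §2 (the verified check `psdCert`), this file; part II = §3 (soundness) + §4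
(smoke test) in `PsdCert.lean`, which imports this file.
-/

namespace Summit.HubbardSuperconductivity.HubbardLadder.PsdCert

open Finset

/-! ## §1 The untrusted oracle: fixed-point LDLᵀ of `B − μ·1` (nothing about it is proved) -/

/-- `tail − l̂·rest / s`, elementwise over the common prefix (fixed-point row update of the Schur complement). [folklore] -/
def zipElim (s l : ℤ) : List ℤ → List ℤ → List ℤ
  | t :: ts, r :: rs => Int.sub t (Int.ediv (Int.mul l r) s) :: zipElim s l ts rs
  | _, _ => []

/-- Eliminate the rows below a pivot `d` whose row tail is `rest`: returns the column of `L̂` below the pivot (scale `s`)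
and the reduced rows. [folklore] -/
def elimBelow (s d : ℤ) (rest : List ℤ) : List (List ℤ) → List ℤ × List (List ℤ)
  | [] => ([], [])
  | [] :: rows =>
      let r := elimBelow s d rest rows
      (0 :: r.1, [] :: r.2)
  | (c :: tail) :: rows =>
      let l := Int.ediv (Int.mul c s) d
      let r := elimBelow s d rest rows
      (l :: r.1, zipElim s l tail rest :: r.2)

/-- The fixed-point LDLᵀ oracle on `fuel` rows: the pivots `D̂` and the strictly-lower columns of `L̂` (scale `s`).
A vanishing pivot is replaced by `1` inside the oracle only (the check in §2 does not care how `L̂, D̂` were obtained). [folklore] -/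
def fpLDL (s : ℤ) : ℕ → List (List ℤ) → List ℤ × List (List ℤ)
  | 0, _ => ([], [])
  | _ + 1, [] => ([], [])
  | _ + 1, [] :: _ => ([], [])
  | fuel + 1, (d :: rest) :: rows =>
      let d' : ℤ := if d = 0 then 1 else d
      let cr := elimBelow s d' rest rows
      let tl := fpLDL s fuel cr.2
      (d :: tl.1, cr.1 :: tl.2)

/-- Rows of the lower-triangular `L̂` (row `i` = `[L̂_i0, …, L̂_i,i-1, s]`) assembled from its strictly-lower columns. [folklore] -/
def lowerRows (s : ℤ) : List (List ℤ) → List (List ℤ)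
  | [] => []
  | col :: cols => [s] :: List.zipWith (fun l row => l :: row) col (lowerRows s cols)

/-- Subtract `μ` on the diagonal (row counter `i`). [folklore] -/
def subDiag (μ : ℤ) : ℕ → List (List ℤ) → List (List ℤ)
  | _, [] => []
  | i, r :: rs =>
      (List.zipWith (fun (j : ℕ) (x : ℤ) => if j = i then x - μ else x) (List.range r.length) r) :: subDiag μ (i + 1) rs

/-! ## §2 The verified check -/

/-- Entry `(i,j)` of a list-of-rows matrix, `0` outside. [folklore] -/
def ent (B : List (List ℤ)) (i j : ℕ) : ℤ := (B.getD i []).getD j 0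

/-- `Σ_k a_k d_k b_k` over the common prefix (the `(i,j)` entry of `L̂·diag(D̂)·L̂ᵀ` from rows `a = L̂_i`, `b = L̂_j`) — the
SPECIFICATION (structural, used in the proofs). [folklore] -/
def dot3 : List ℤ → List ℤ → List ℤ → ℤ
  | a :: as, d :: ds, b :: bs => Int.add (Int.mul (Int.mul a d) b) (dot3 as ds bs)
  | _, _, _ => 0

/-- Kernel-evaluation helper: force the integer `x` to a numeral (constructor + literal) before continuing with `f`; semantically
the identity `forceZ x f = f x` (`forceZ_eq`).  Keeps the kernel's recursion depth bounded in long accumulations. [folklore] -/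
def forceZ {α : Type} (x : ℤ) (f : ℤ → α) : α :=
  match x with
  | Int.ofNat 0 => f (Int.ofNat 0)
  | Int.ofNat (k + 1) => f (Int.ofNat (k + 1))
  | Int.negSucc 0 => f (Int.negSucc 0)
  | Int.negSucc (k + 1) => f (Int.negSucc (k + 1))

/-- `forceZ` is the identity. [folklore] -/
theorem forceZ_eq {α : Type} (x : ℤ) (f : ℤ → α) : forceZ x f = f x := by
  rcases x with (_ | _) | (_ | _) <;> rfl

/-- Tail-recursive, accumulator-forced evaluation of `acc + dot3 a d b` (what the kernel runs; `dot3acc_eq`). [folklore] -/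
def dot3acc : ℤ → List ℤ → List ℤ → List ℤ → ℤ
  | acc, a :: as, d :: ds, b :: bs => forceZ (Int.add acc (Int.mul (Int.mul a d) b)) fun acc' => dot3acc acc' as ds bs
  | acc, _, _, _ => acc

/-- `dot3acc acc a d b = acc + dot3 a d b`. [folklore] -/
theorem dot3acc_eq (a d b : List ℤ) : ∀ acc : ℤ, dot3acc acc a d b = acc + dot3 a d b := by
  induction a generalizing d b with
  | nil => intro acc; simp [dot3acc, dot3]
  | cons x xs ih =>
    intro acc
    cases d with
    | nil => simp [dot3acc, dot3]
    | cons y ys =>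
      cases b with
      | nil => simp [dot3acc, dot3]
      | cons z zs =>
        simp only [dot3acc, dot3, forceZ_eq, ih]
        change acc + x * y * z + dot3 xs ys zs = acc + (x * y * z + dot3 xs ys zs)
        ring

/-- Row `i` of the exact residual `E = s²·B − L̂ D̂ L̂ᵀ` (as long as the shorter of `B_i`, `Lrows`). [folklore] -/
def erow (s2 : ℤ) (D : List ℤ) (Lrows : List (List ℤ)) (Bi Li : List ℤ) : List ℤ :=
  List.zipWith (fun bij lj => Int.sub (Int.mul bij s2) (dot3acc 0 Li D lj)) Bi Lrows

/-- `Σ_j |row_j|` (specification). [folklore] -/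
def absSum : List ℤ → ℤ
  | [] => 0
  | e :: es => |e| + absSum es

/-- `Σ_{j ≠ i} |row_j|` (position `i` skipped; specification). [folklore] -/
def offAbs : ℕ → List ℤ → ℤ
  | _, [] => 0
  | 0, _ :: es => absSum es
  | i + 1, e :: es => |e| + offAbs i es

/-- Tail-recursive, accumulator-forced `acc + absSum row` (what the kernel runs). [folklore] -/
def absSumAcc : ℤ → List ℤ → ℤ
  | acc, [] => acc
  | acc, e :: es => forceZ (Int.add acc (e.natAbs : ℤ)) fun acc' => absSumAcc acc' es

/-- Tail-recursive, accumulator-forced `acc + offAbs i row` (what the kernel runs). [folklore] -/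
def offAbsAcc : ℤ → ℕ → List ℤ → ℤ
  | acc, _, [] => acc
  | acc, 0, _ :: es => absSumAcc acc es
  | acc, i + 1, e :: es => forceZ (Int.add acc (e.natAbs : ℤ)) fun acc' => offAbsAcc acc' i es

/-- `absSumAcc acc row = acc + absSum row`. [folklore] -/
theorem absSumAcc_eq (row : List ℤ) : ∀ acc : ℤ, absSumAcc acc row = acc + absSum row := by
  induction row with
  | nil => intro acc; simp [absSumAcc, absSum]
  | cons e es ih =>
    intro acc
    simp only [absSumAcc, absSum, forceZ_eq, ih, Int.natCast_natAbs]
    change acc + |e| + absSum es = acc + (|e| + absSum es)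
    ring

/-- `offAbsAcc acc i row = acc + offAbs i row`. [folklore] -/
theorem offAbsAcc_eq (row : List ℤ) : ∀ (i : ℕ) (acc : ℤ), offAbsAcc acc i row = acc + offAbs i row := by
  induction row with
  | nil => intro i acc; simp [offAbsAcc, offAbs]
  | cons e es ih =>
    intro i acc
    cases i with
    | zero => simp [offAbsAcc, offAbs, absSumAcc_eq]
    | succ i =>
      simp only [offAbsAcc, offAbs, forceZ_eq, ih, Int.natCast_natAbs]
      change acc + |e| + offAbs i es = acc + (|e| + offAbs i es)
      ring

/-- All rows of `E` diagonally dominant with the diagonal on top: `Σ_{j≠i} |E_ij| ≤ E_ii` (row counter `i`). [folklore] -/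
def ddRows (s2 : ℤ) (D : List ℤ) (Lrows : List (List ℤ)) : ℕ → List (List ℤ) → List (List ℤ) → Bool
  | _, [], _ => true
  | _, _ :: _, [] => false
  | i, Bi :: Bs, Li :: Ls =>
      (let r := erow s2 D Lrows Bi Li
       decide (offAbsAcc 0 i r ≤ r.getD i 0)) && ddRows s2 D Lrows (i + 1) Bs Ls

/-- `B` has `n` rows, each of length `n`. [folklore] -/
def isSquare (n : ℕ) (B : List (List ℤ)) : Bool :=
  decide (B.length = n) && B.all fun r => decide (r.length = n)

/-- `B` is symmetric on `n × n` (entrywise test). [folklore] -/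
def isSymm (n : ℕ) (B : List (List ℤ)) : Bool :=
  (List.range n).all fun i => (List.range n).all fun j => decide (ent B i j = ent B j i)

/-- **The certificate check.** `psdCert n s μ B`: run the fixed-point LDLᵀ oracle on `B − μ·1` at scale `s`, then verify
EXACTLY that `0 < s`, `B` is square and symmetric, the factor has `n` rows, all pivots are `≥ 0`, and `s²B − L̂D̂L̂ᵀ` is
row-diagonally-dominant.  Decided by `decide +kernel`; sound by `form_nonneg_of_psdCert`. [folklore] -/
def psdCert (n : ℕ) (s : ℕ) (μ : ℤ) (B : List (List ℤ)) : Bool :=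
  let f := fpLDL (s : ℤ) n (subDiag μ 0 B)
  let D := f.1
  let Lrows := lowerRows (s : ℤ) f.2
  decide (0 < s) && isSquare n B && isSymm n B && decide (Lrows.length = n) &&
    D.all (fun d => decide (0 ≤ d)) && ddRows ((s : ℤ) * (s : ℤ)) D Lrows 0 B Lrows

end Summit.HubbardSuperconductivity.HubbardLadder.PsdCert
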